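import Summits.RiemannHypothesis.RiemannHypothesis.Theses.SpectralTrace
import Summits.RiemannHypothesis.RiemannHypothesis.Theorems.WindowTraceArch.Negative.ComplexSpectrum
import Literature.NumberTheory.LFunctions.WeilArchimedeanPositivityHolds
import Literature.NumberTheory.LFunctions.RiemannHypothesisUpTo101
import Literature.NumberTheory.LFunctions.ZetaArgVariation
import Literature.NumberTheory.LFunctions.ZetaZerosReflection
import Literature.NumberTheory.LFunctions.ZetaZerosProofs

/-!
# Line `dressing-continuity` — checked skeleton for the crux `WindowTraceArch`
(stmt-RiemannHypothesis-11195, route SpectralTrace; crux-strategist, BC2 redirect)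

Crux (fixed, by name): `Summit.RiemannHypothesis.RiemannHypothesis.Theses.SpectralTrace.WindowTraceArch`
= Trace(log 2): some REAL family `γ'` reproduces `W(g)` (`HasSum`) on every Weil test supported in
`[-log 2, log 2]`.

THE LINE = the typed decomposition filed on the route (rev 22):
`WindowTraceArch ⟸ UndressingPrinciple ∧ DressedZeros` (glue item `WindowTraceArchOfUndressing`,
stmt-RiemannHypothesis-17988, proof attached as evidence / `Theorems/SpectralTraceWindowTraceArchSplit.lean`).

* `DressedZeros` (stmt-17979, provable now): the explicit formula with absolute convergence
  (`hasSum_weilMellin_zeros`, LANDED) says the zeros `ρ = 1/2 + b + iγ` with multiplicity are an EXACT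
  COMPLEX spectrum for `W`; read as REAL points `γ` carrying DRESSINGS `b ∈ (-1/2, 1/2)`, with `b = 0`
  below height `100` (`riemannHypothesisUpTo_hundredOne`), symmetric under `(b,γ) ↦ (b,-γ), (-b,γ)`
  (conjugation / functional equation with multiplicities), obeying Riemann–von Mangoldt
  (`riemann_von_mangoldt_holds`). Stubs E, F, G below + `DressedZeros_of`.
* `UndressingPrinciple` (stmt-17980, the crux of the line, universal and ζ-free): such a dressed real
  configuration whose functional `S` is Weil-positive on the half window is reproduced on the window by
  an honest real unit-multiplicity family. MECHANISM = CONTINUITY METHOD ON THE SEGMENT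
  `S_t := (1-t)·S₀ + t·S₁`, `t ∈ [0,1]`, between the UNDRESSED functional `S₀ = Σ ĝ(1/2+iγ_i)`
  (realised trivially by `γ` itself) and the dressed one `S₁ = S`. The segment stays Weil-positive by
  CONVEXITY (both ends are: `S₀` is a sum of `|ĥ(γ_i)|²`, `S₁` by hypothesis) — this is why the path is
  the convex segment and not the dressing scale `b ↦ s·b`. Stubs: A `stub_summable` (the undressed
  series converges absolutely on Weil tests: decay of `ĝ` + the counting law), B `stub_apriori`
  (RIGIDITY: whenever `S_t` is realised by some real family it is realised by a BOUNDED DISPLACEMENT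
  `γ + δ`, `|δ_i| ≤ M`, of the data's own points, `M` depending on the data only — the analogue of the
  landed structure theorem `stub_structureAssembly`/`stub_displacementBound` for witnesses of `W`),
  C `stub_closed` (the set of `t` realised within displacement `M` is CLOSED: Helly selection on
  `[-M,M]^ι₀` + Tannery, as in the landed `windowCompactness_proof` / `stub_compactness`),
  D `stub_open` (HARDEST: realisability is OPEN along the segment — perturbative undressing of an
  exactly realised Weil-positive functional in the fixed direction `D = S₁ - S₀ = Σ_pairs
  (2cosh(b x) - 2)·2cos(γ x)`, a smooth FAR-FIELD pair defect of size `O(b²)` per pair; the linearised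
  healing operator `δ ↦ Σ δ_i ∂_γ ĝ(1/2+i(γ_i+δ_i))` at a bounded-displacement configuration of
  Riemann–von Mangoldt density `log T/2π ≫ (log 2)/π` above height `100` has a frequency-localised
  bounded right inverse by frame density (Seip/Jaffard; localised frames à la Gröchenig give the `ℓ^∞`
  control), then the implicit function theorem). Composition `UndressingPrinciple_of`: `U := {t ∈ [0,1] :
  S_t realised within M}` contains `0`, is clopen, `[0,1]` is connected ⇒ `1 ∈ U`.

`WindowTraceArch_of` (the seven stub statements ⟹ the crux BY NAME) is kernel-checked with no `sorry`;
`WindowTraceArch_proof` instantiates it with the registered (sorried) stubs. Positivity of `W` on the half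
window is Yoshida's theorem `weilPositivityOn_log_two_half_holds` (PROVED), used in the composition.

Disproof.lean honoured: `windowTraceArch_false_without_isWeilTest` — every identity is over `IsWeilTest`
tests; `infinite_of_windowTrace` / `not_bounded_localCount_of_windowTrace` / `card_near_le_log_of_windowTrace`
— the witness is a bounded displacement of the zero ordinates (infinite, local count `≍ log T`);
`hasSum_weilMellin_zeros` (§3 of the dossier) is USED, as the exact dressed configuration — the line is
ζ-free above it; `not_mem_range_of_windowTraceArch_witness` (forbidden zones) — the undressed bottom block
IS ζ's ordinates (`14.13, 21.02, …`), outside the forbidden set. No landed `Negative/*` lemma is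
contradicted by any stub instance (the stubs are universal over dressed data; their ζ-instance is RH-implied).
-/

set_option linter.unusedVariables false
set_option linter.dupNamespace false

noncomputable section

open Complex Filter Set MeasureTheory
open scoped Real Topology

namespace Summit.RiemannHypothesis.RiemannHypothesis.Cruxes.WindowTraceArch.DressingContinuity

open Literature.NumberTheory.LFunctions
open Summit.RiemannHypothesis.RiemannHypothesis.Theses.SpectralTrace

/-! ## Vocabulary (definitions only, no `sorry`) -/

/-- The window `[-log 2, log 2]` condition on a test. -/
def OnWindow (g : ℝ → ℂ) : Prop :=
  IsWeilTest g ∧ tsupport g ⊆ Icc (-Real.log 2) (Real.log 2)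

/-- `IsDressedConfig ι₀ γ b`: hypotheses H1–H4 of `UndressingPrinciple` (profile, far-field dressing,
the two symmetries, the two-sided Riemann–von Mangoldt law). -/
def IsDressedConfig (ι₀ : Type) (γ b : ι₀ → ℝ) : Prop :=
  (∀ i, |b i| < 1 / 2) ∧
  (∀ i, |γ i| ≤ 100 → b i = 0) ∧
  (∃ e : ι₀ ≃ ι₀, ∀ i, γ (e i) = -γ i ∧ b (e i) = b i) ∧
  (∃ e : ι₀ ≃ ι₀, ∀ i, γ (e i) = γ i ∧ b (e i) = -b i) ∧
  (∃ C T₀ : ℝ, ∀ T : ℝ, T₀ ≤ T → {i : ι₀ | |γ i| ≤ T}.Finite ∧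
    |(({i : ι₀ | |γ i| ≤ T}.ncard : ℕ) : ℝ) -
        2 * (T / (2 * Real.pi) * Real.log (T / (2 * Real.pi)) - T / (2 * Real.pi))| ≤
      C * Real.log T)

/-- H5: the dressed series sums to `S` on every Weil test. -/
def DressedSumsTo {ι₀ : Type} (γ b : ι₀ → ℝ) (S : (ℝ → ℂ) → ℂ) : Prop :=
  ∀ g : ℝ → ℂ, IsWeilTest g →
    HasSum (fun i => weilMellin g (1 / 2 + (b i : ℂ) + (γ i : ℂ) * I)) (S g)

/-- H6: `S` is Weil-positive on autocorrelations of tests supported in the half window. -/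
def HalfWindowPositive (S : (ℝ → ℂ) → ℂ) : Prop :=
  ∀ h : ℝ → ℂ, IsWeilTest h → tsupport h ⊆ Icc (-(Real.log 2 / 2)) (Real.log 2 / 2) →
    0 ≤ (S (weilConv h (weilReflect h))).re

/-- All hypotheses of `UndressingPrinciple`, bundled. -/
def Hyp (ι₀ : Type) (γ b : ι₀ → ℝ) (S : (ℝ → ℂ) → ℂ) : Prop :=
  IsDressedConfig ι₀ γ b ∧ DressedSumsTo γ b S ∧ HalfWindowPositive S

/-- The SEGMENT functional `S_t g := Σ_i [(1-t)·ĝ(1/2+iγ_i) + t·ĝ(1/2+b_i+iγ_i)]` (a `tsum`; its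
summability on Weil tests is stub A + H5). `S_0` = undressed, `S_1` = dressed; Weil positivity is
convex, so every `S_t` is Weil-positive on the half window when `S_1` is. -/
def segFunctional {ι₀ : Type} (γ b : ι₀ → ℝ) (t : ℝ) (g : ℝ → ℂ) : ℂ :=
  ∑' i, (((1 - t : ℝ) : ℂ) * weilMellin g (1 / 2 + (γ i : ℂ) * I) +
    ((t : ℝ) : ℂ) * weilMellin g (1 / 2 + (b i : ℂ) + (γ i : ℂ) * I))

/-- `Realised γ b t`: SOME real unit-multiplicity family reproduces `S_t` on the window tests. -/
def Realised {ι₀ : Type} (γ b : ι₀ → ℝ) (t : ℝ) : Prop :=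
  ∃ (ι : Type) (γ' : ι → ℝ), ∀ g : ℝ → ℂ, OnWindow g →
    HasSum (fun j => weilMellin g (1 / 2 + (γ' j : ℂ) * I)) (segFunctional γ b t g)

/-- `RealisedWithin γ b M t`: `S_t` is reproduced on the window tests by a BOUNDED REAL DISPLACEMENT
`γ + δ`, `|δ_i| ≤ M`, of the data's own points (indexed by `ι₀` itself; multiplicities allowed). -/
def RealisedWithin {ι₀ : Type} (γ b : ι₀ → ℝ) (M t : ℝ) : Prop :=
  ∃ δ : ι₀ → ℝ, (∀ i, |δ i| ≤ M) ∧ ∀ g : ℝ → ℂ, OnWindow g →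
    HasSum (fun i => weilMellin g (1 / 2 + ((γ i + δ i : ℝ) : ℂ) * I)) (segFunctional γ b t g)

/-- The unit segment as a (preconnected) subtype. -/
abbrev Seg : Type := Icc (0 : ℝ) 1

/-- `U_M := {t ∈ [0,1] : S_t realised within displacement M}`. -/
def realisedSet {ι₀ : Type} (γ b : ι₀ → ℝ) (M : ℝ) : Set Seg :=
  {t | RealisedWithin γ b M t.1}

/-! ## The zero data (for `DressedZeros`) -/

/-- Index type of the non-trivial zeros repeated with multiplicity (as in `hasSum_weilMellin_zeros`). -/
abbrev ZIdx : Type :=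
  Σ ρ : ZetaZeros.riemannZetaNontrivialZeros, Fin (riemannZetaZeroOrder (ρ : ℂ)).toNat

/-- Ordinate of the slot. -/
def zγ (p : ZIdx) : ℝ := ((p.1 : ℂ)).im

/-- Dressing of the slot: `Re ρ - 1/2`. -/
def zb (p : ZIdx) : ℝ := ((p.1 : ℂ)).re - 1 / 2

/-! ## The seven stub STATEMENTS -/

namespace Stmt

/-- STUB A — SUMMABILITY of the undressed series (size M). For dressed-configuration data the
undressed series `Σ_i ĝ(1/2 + iγ_i)` converges (absolutely) on every Weil test: `|ĝ(1/2+it)| ≪_g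
(1+t²)⁻¹` (two integrations by parts, `g ∈ C_c^∞`) and `Σ_i (1+γ_i²)⁻¹ < ∞` from the counting law
H4 by partial summation (cf. the landed `summable_norm_zeroSide` for the zeros themselves). -/
def stub_summable : Prop :=
  ∀ (ι₀ : Type) (γ b : ι₀ → ℝ) (S : (ℝ → ℂ) → ℂ), Hyp ι₀ γ b S →
    ∀ g : ℝ → ℂ, IsWeilTest g → Summable (fun i => weilMellin g (1 / 2 + (γ i : ℂ) * I))

/-- STUB B — A PRIORI RIGIDITY (size L). There is a displacement budget `M = M(data)` such that, for
every `t ∈ [0,1]`, if `S_t` is realised by SOME real family then it is realised by a bounded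
displacement `γ + δ`, `|δ_i| ≤ M`, of the data's own points. Mechanism: the window identity forces the
witness's counting function to match the data's to `O(log T)` (Beurling–Selberg band-limited
majorants of type `≤ log 2` tested against `S_t`, whose kernel differs from the undressed one by the
bounded far-field factor `(1-t) + t·cosh(b x)`), and two real sequences with Riemann–von Mangoldt
density and `O(log T)` discrepancy admit a sorted matching within bounded distance — the argument of
the LANDED structure theorem for witnesses of `W` (`stub_countingLaw`, `stub_sortedEnumeration`,
`stub_displacementBound`, `stub_structureAssembly` in `Theorems/SpectralTraceWindowTraceArch*`). -/
def stub_apriori : Prop :=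
  ∀ (ι₀ : Type) (γ b : ι₀ → ℝ) (S : (ℝ → ℂ) → ℂ), Hyp ι₀ γ b S →
    ∃ M : ℝ, ∀ t : ℝ, t ∈ Icc (0 : ℝ) 1 → Realised γ b t → RealisedWithin γ b M t

/-- STUB C — CLOSEDNESS (size L). For every budget `M`, the set of `t ∈ [0,1]` at which `S_t` is
realised within displacement `M` is closed: along `t_n → t`, the displacement fields `δ⁽ⁿ⁾ ∈ [-M,M]^ι₀`
have a pointwise convergent subnet (Tychonoff) — or Helly selection on the counting measures with the
uniform local bound `#{i : |γ_i + δ_i - T| ≤ 1} ≤ C log T` — and the window identities pass to the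
limit by dominated convergence (`|ĝ(1/2+it)| ≪ (1+t²)⁻¹` uniformly on the moving atoms, `S_{t_n} g →
S_t g` linearly in `t`). Same proof pattern as the landed `windowCompactness_proof` and
`stub_compactness` (Tannery). -/
def stub_closed : Prop :=
  ∀ (ι₀ : Type) (γ b : ι₀ → ℝ) (S : (ℝ → ℂ) → ℂ), Hyp ι₀ γ b S →
    ∀ M : ℝ, IsClosed (realisedSet γ b M)

/-- STUB D — OPENNESS = perturbative undressing (size XL; HARDEST, the bet of the line). If `S_{t₀}`
is realised within displacement `M` then `S_t` is realised (by some real family) for all `t ∈ [0,1]`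
near `t₀`. Mechanism: implicit function theorem at the exact configuration `γ + δ` in the fixed
direction `D = S₁ - S₀ = Σ_pairs (2cosh(b x) - 2)·2cos(γ x)` (by the symmetry `(b,γ) ↦ (-b,γ)` the
first-order dressing cancels: a smooth, even, FAR-FIELD pair defect of relative size `O(b²)`,
supported at frequencies `|γ| > 100` only). Linearisation `δ' ↦ Σ_i δ'_i ∫ g(x)(ix)e^{i(γ_i+δ_i)x}dx`;
a bounded right inverse in sup-normalised displacement units exists because the configuration has
density `log T/(2π) ≫ (log 2)/π` above the capacity height `2πe^{2 log 2} ≈ 25` (frame density on the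
window: Seip 1995, Jaffard 1991, Christensen Thm 9.8.3–9.8.4; `ℓ^∞` bounds from intrinsic
localisation of the canonical dual frame, Gröchenig 2004); quadratic remainder controlled by the
Montgomery–Vaughan Hilbert inequality (in tree). Weil positivity holds along the whole segment by
convexity, so no positivity obstruction can stop the continuation; what can fail is UNIFORMITY of the
right inverse over all data in the class (dense heavy dressing at heights `100–10³`). -/
def stub_open : Prop :=
  ∀ (ι₀ : Type) (γ b : ι₀ → ℝ) (S : (ℝ → ℂ) → ℂ), Hyp ι₀ γ b S →
    ∀ (M : ℝ) (t₀ : Seg), RealisedWithin γ b M t₀.1 →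
      ∃ ε : ℝ, 0 < ε ∧ ∀ t : Seg, |t.1 - t₀.1| < ε → Realised γ b t.1

/-- STUB E — PROFILE of the zeros (size M): `|Re ρ - 1/2| < 1/2` (open critical strip,
`mem_riemannZetaNontrivialZeros_iff_holds`) and `Re ρ = 1/2` whenever `|Im ρ| ≤ 100`
(`riemannHypothesisUpTo_hundredOne` for `Im ρ > 0`, conjugation for `Im ρ < 0`, no real non-trivial
zeros for `Im ρ = 0`). -/
def stub_zeroProfile : Prop :=
  (∀ p : ZIdx, |zb p| < 1 / 2) ∧ (∀ p : ZIdx, |zγ p| ≤ 100 → zb p = 0)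

/-- STUB F — SYMMETRIES of the zeros with multiplicity (size M): conjugation `ρ ↦ ρ̄`
(`riemannZetaZeroOrder_conj_holds`) and reflection `ρ ↦ 1 - ρ̄` (`riemannZetaZeroOrder_one_sub_holds`)
induce self-equivalences of the multiplicity sigma type (`Fin.cast` along the equal orders). -/
def stub_zeroSymm : Prop :=
  (∃ e : ZIdx ≃ ZIdx, ∀ p, zγ (e p) = -zγ p ∧ zb (e p) = zb p) ∧
  (∃ e : ZIdx ≃ ZIdx, ∀ p, zγ (e p) = zγ p ∧ zb (e p) = -zb p)

/-- STUB G — COUNTING LAW for the zeros (size M/L): the two-sided Riemann–von Mangoldt law with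
multiplicity, from `riemann_von_mangoldt_holds` (`N(T) = (T/2π)log(T/2π) - T/2π + O(log T)`,
PROVED) and `ncard {p : |Im ρ_p| ≤ T} = 2·zetaZeroCount T` (conjugation symmetry; no real zeros). -/
def stub_zeroCount : Prop :=
  ∃ C T₀ : ℝ, ∀ T : ℝ, T₀ ≤ T → {p : ZIdx | |zγ p| ≤ T}.Finite ∧
    |(({p : ZIdx | |zγ p| ≤ T}.ncard : ℕ) : ℝ) -
        2 * (T / (2 * Real.pi) * Real.log (T / (2 * Real.pi)) - T / (2 * Real.pi))| ≤
      C * Real.log T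

end Stmt

/-! ## Registered stubs -/

/-- **stub A — summability of the undressed series.** Size M. -/
theorem stub_summable : Stmt.stub_summable := by
  sorry

/-- **stub B — a priori rigidity (bounded displacement).** Size L. -/
theorem stub_apriori : Stmt.stub_apriori := by
  sorry

/-- **stub C — closedness along the segment.** Size L. -/
theorem stub_closed : Stmt.stub_closed := by
  sorry

/-- **stub D — openness along the segment (perturbative undressing).** Size XL; hardest. -/
theorem stub_open : Stmt.stub_open := by
  sorry

/-- **stub E — profile of the zeros.** Size M. -/
theorem stub_zeroProfile : Stmt.stub_zeroProfile := by
  sorry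

/-- **stub F — symmetries of the zeros with multiplicity.** Size M. -/
theorem stub_zeroSymm : Stmt.stub_zeroSymm := by
  sorry

/-- **stub G — two-sided Riemann–von Mangoldt with multiplicity.** Size M/L. -/
theorem stub_zeroCount : Stmt.stub_zeroCount := by
  sorry

/-! ## Compositions (kernel-checked, no `sorry`) -/

/-- At `t = 1` the segment functional is the dressed sum `S`. -/
theorem segFunctional_one {ι₀ : Type} {γ b : ι₀ → ℝ} {S : (ℝ → ℂ) → ℂ}
    (h5 : DressedSumsTo γ b S) {g : ℝ → ℂ} (hg : IsWeilTest g) :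
    segFunctional γ b 1 g = S g := by
  unfold segFunctional
  have : (fun i => (((1 - (1 : ℝ) : ℝ) : ℂ) * weilMellin g (1 / 2 + (γ i : ℂ) * I) +
      (((1 : ℝ) : ℝ) : ℂ) * weilMellin g (1 / 2 + (b i : ℂ) + (γ i : ℂ) * I))) =
      fun i => weilMellin g (1 / 2 + (b i : ℂ) + (γ i : ℂ) * I) := by
    funext i; push_cast; ring
  rw [this]
  exact (h5 g hg).tsum_eq

/-- At `t = 0` the segment functional is the undressed sum, realised by the data itself. -/
theorem realised_zero {ι₀ : Type} {γ b : ι₀ → ℝ} {S : (ℝ → ℂ) → ℂ}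
    (hA : Stmt.stub_summable) (h : Hyp ι₀ γ b S) : Realised γ b 0 := by
  refine ⟨ι₀, γ, fun g hg => ?_⟩
  have hs := hA ι₀ γ b S h g hg.1
  unfold segFunctional
  have : (fun i => (((1 - (0 : ℝ) : ℝ) : ℂ) * weilMellin g (1 / 2 + (γ i : ℂ) * I) +
      (((0 : ℝ) : ℝ) : ℂ) * weilMellin g (1 / 2 + (b i : ℂ) + (γ i : ℂ) * I))) =
      fun i => weilMellin g (1 / 2 + (γ i : ℂ) * I) := by
    funext i; push_cast; ring
  rw [this]
  exact hs.hasSum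

/-- **Composition for the crux of the line**: stubs A–D ⟹ `UndressingPrinciple` (the route decl, by
name). Continuity method: `U_M ⊆ [0,1]` is nonempty (t = 0, via A + B), closed (C) and open (D + B);
`[0,1]` is preconnected, so `U_M = [0,1] ∋ 1`, and `S_1 = S` (H5). -/
theorem UndressingPrinciple_of (hA : Stmt.stub_summable) (hB : Stmt.stub_apriori)
    (hC : Stmt.stub_closed) (hD : Stmt.stub_open) : UndressingPrinciple := by
  intro ι₀ γ b S h1 h2 h3 h4 hcount h5 h6
  have hH : Hyp ι₀ γ b S := ⟨⟨h1, h2, h3, h4, hcount⟩, h5, h6⟩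
  obtain ⟨M, hM⟩ := hB ι₀ γ b S hH
  -- the set U_M
  set U : Set Seg := realisedSet γ b M with hU
  have h0mem : (⟨0, by norm_num, by norm_num⟩ : Seg) ∈ U := by
    show RealisedWithin γ b M 0
    exact hM 0 ⟨le_rfl, zero_le_one⟩ (realised_zero hA hH)
  have hclosed : IsClosed U := hC ι₀ γ b S hH M
  have hopen : IsOpen U := by
    rw [Metric.isOpen_iff]
    intro t₀ ht₀
    obtain ⟨ε, hε, hball⟩ := hD ι₀ γ b S hH M t₀ ht₀
    refine ⟨ε, hε, fun t ht => ?_⟩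
    have hdist : |t.1 - t₀.1| < ε := by
      have := Metric.mem_ball.1 ht
      rwa [Subtype.dist_eq, Real.dist_eq] at this
    exact hM t.1 t.2 (hball t hdist)
  haveI : PreconnectedSpace Seg := Subtype.preconnectedSpace isPreconnected_Icc
  have hUniv : U = Set.univ := IsClopen.eq_univ ⟨hclosed, hopen⟩ ⟨_, h0mem⟩
  have h1mem : (⟨1, zero_le_one, le_rfl⟩ : Seg) ∈ U := by rw [hUniv]; trivial
  obtain ⟨δ, -, hδ⟩ := (show RealisedWithin γ b M 1 from h1mem)
  refine ⟨ι₀, fun i => γ i + δ i, fun g hg hgs => ?_⟩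
  have := hδ g ⟨hg, hgs⟩
  rwa [segFunctional_one h5 hg] at this

/-- `1/2 + (Re ρ - 1/2) + (Im ρ)·I = ρ`. -/
theorem half_add_zb_add_zγ (p : ZIdx) :
    (1 / 2 : ℂ) + ((zb p : ℝ) : ℂ) + ((zγ p : ℝ) : ℂ) * I = (p.1 : ℂ) := by
  apply Complex.ext <;> simp [zb, zγ]

/-- **Composition for the instance**: stubs E–G ⟹ `DressedZeros` (the route decl, by name); H5 is the
landed explicit formula with absolute convergence `hasSum_weilMellin_zeros`. -/
theorem DressedZeros_of (hE : Stmt.stub_zeroProfile) (hF : Stmt.stub_zeroSymm)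
    (hG : Stmt.stub_zeroCount) : DressedZeros := by
  refine ⟨ZIdx, zγ, zb, hE.1, hE.2, hF.1, hF.2, hG, fun g hg => ?_⟩
  have h := Theorems.WindowTraceArch.Negative.hasSum_weilMellin_zeros hg
  have hfun : (fun p : ZIdx => weilMellin g (1 / 2 + ((zb p : ℝ) : ℂ) + ((zγ p : ℝ) : ℂ) * I)) =
      fun p : ZIdx => weilMellin g (p.1 : ℂ) := by
    funext p; rw [half_add_zb_add_zγ]
  rw [hfun]
  exact h

/-- **Composition for the crux `WindowTraceArch` BY NAME**: the seven stub statements imply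
`WindowTraceArch` — `UndressingPrinciple_of` + `DressedZeros_of` + the glue (instantiate at
`S := weilFunctional`; Weil positivity on the half window is Yoshida's theorem
`weilPositivityOn_log_two_half_holds`, PROVED). -/
theorem WindowTraceArch_of (hA : Stmt.stub_summable) (hB : Stmt.stub_apriori)
    (hC : Stmt.stub_closed) (hD : Stmt.stub_open) (hE : Stmt.stub_zeroProfile)
    (hF : Stmt.stub_zeroSymm) (hG : Stmt.stub_zeroCount) : WindowTraceArch := by
  have h₁ : UndressingPrinciple := UndressingPrinciple_of hA hB hC hD
  obtain ⟨ι₀, γ, b, hb, hfar, hconj, hrefl, hcount, hsum⟩ := DressedZeros_of hE hF hG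
  have hpos : WeilPositivityOn (Real.log 2 / 2) := weilPositivityOn_log_two_half_holds
  exact h₁ ι₀ γ b weilFunctional hb hfar hconj hrefl hcount hsum (fun h hh hs => hpos h hh hs)

/-- The skeleton instantiated with the registered (sorried) stubs. -/
theorem WindowTraceArch_proof : WindowTraceArch :=
  WindowTraceArch_of stub_summable stub_apriori stub_closed stub_open stub_zeroProfile stub_zeroSymm
    stub_zeroCount

end Summit.RiemannHypothesis.RiemannHypothesis.Cruxes.WindowTraceArch.DressingContinuity

end
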